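import Summits.Ventures.PackingBounds.ThreePointCert.K5d14Agg1
import Summits.Ventures.PackingBounds.ThreePointCert.K5d14Agg2
import Summits.Ventures.PackingBounds.ThreePointCert.K5d14Agg3
import Summits.Ventures.PackingBounds.ThreePointCert.CheckFastFZ

/-!
# κ(5) ≤ 44: kernel validation of the blocks of (i') and of the `FI` expansion (part 12 of 16; one kernel validation per file, lp gen 8)

Framing: lottery ticket; floor = certified bounds/negative ranges. Venture `PackingBounds` (cell
`pub-packcert`), three-point SDP family. Integer data of a feasible point of the Bachoc–Vallentin
semidefinite program (n = 5, s = 1/2, degree d = 14, Bachoc–Vallentin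
multiplier set = cell mode sym2), derived by `cert2lean_s2.py` (sdp gen 5 fork of cert2lean_lp.py) from the exact rational certificate
`sdp-d5-deg14-sym2-lp-v1.json` of the cell (exact verifier #1 + verifier #2 of the other seat), in the units of the kernel
checker `ThreePointCert.Check` + `CheckSym2` (soundness `card_le_of_cert3S2`); Gram factors offset-encoded for the
Kronecker-packed chunk validation `ThreePointCert.CheckKron` (emitter `emitleanS2.py` = lp gen 3 emitleanK.py). Generated file: plain
lists of integers / monomials.
-/

namespace Summit.Ventures.PackingBounds.ThreePointCert.K5d14

open Literature.Geometry.DiscreteGeometry Literature.Geometry.DiscreteGeometry.PolyCert PolyCert.SPoly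

set_option maxRecDepth 100000 in
set_option maxHeartbeats 0 in
/-- `FI` expansion, blocks [9] (kernel, Gram form + sorted-merge zero test). -/
theorem okF_10 : FchunkOKZ K5d14.cert.n K5d14.cert.d [FBlk.mk 9 K5d14.fw9] K5d14.dFc9 K5d14.dFc10 = true := by
  decide +kernel

end Summit.Ventures.PackingBounds.ThreePointCert.K5d14
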